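import Mathlib
import HarnessLib
import Summits.HubbardSuperconductivity.HubbardSuperconductivity.Theorems.KLProgrammeKLRegimeSplitEdgeFactsRungJets
import Summits.HubbardSuperconductivity.HubbardSuperconductivity.Theorems.KLProgrammeKLRegimeSplitEdgeFactsTransferLines

/-!
# Route `KLProgramme` — edge facts for the pair masses ACROSS TRANSFERS, VII: TRANSPORT OF THE SHELL SIZES across a deep step `Q` — the composed jet rows
# of `…RungJets` with hypotheses AT THE CENTRE MOMENTUM ONLY

Cell gate-hubbard-kl, seat hubbard-kl-k3c1-p1 (g21; child-1 lineage; technique: composed-map remainder propagation).  Row 21 (`…RungJets`) bounds `‖δ²_Q(φ·ĝ_K)(ν,p)‖`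
by `C·|p_Q|_𝕋²` given the rung size `‖ĝ_K(ν,·)‖ ≤ g` and the band size `|e_K(·)| ≤ E` at the THREE momenta `p − Q, p, p + Q`.  On the support of a scale-`j` symbol
only the CENTRE sizes are model facts (`ω_ν² + e_K(p)² ≥ A²` ⟹ `‖ĝ_K(ν,p)‖ ≤ 1/A`, hard line `…TransferLines`); THIS FILE transports them across the step under the
DEEP CONDITION `(4 + coeffNorm 1 K)·|p_Q|_𝕋 ≤ A/2` (the band moves by at most half the shell radius):

* §1 `A² ≤ ω² + e²`, `|e′ − e| ≤ A/2` ⟹ `(A/2)² ≤ ω² + e′²` (`klrt_quarter_sq_le`, three cases on `|e|`); `A² ≤ ω_ν² + e_K(p)²` ⟹ `‖ĝ_K(ν,p)‖ ≤ 1/A`;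
* §2 transport: `A² ≤ ω_ν² + e_K(p)²` and the deep condition ⟹ **`‖ĝ_K(ν,p′)‖ ≤ 2/A` at `p′ = p−Q, p, p+Q`**; `|e_K(p)| ≤ E` ⟹ `|e_K(p±Q)| ≤ E + A/2`;
* §3 the composed rows from centre data: **`‖δ²_Q(w_Λ·ĝ_K)(ν,p)‖ ≤ C(E + A/2, Λ, 2/A)·|p_Q|_𝕋²`** and the complementary-member twin, `C` the closed form of row 21 §4/§5.

So for (D2)-deep the E1 producer supplies, per scale, only: the centre shell facts on the supports (`A ≍ Λ_j`, `E ≍ Λ_j`), the deep condition (true for `Q` in the pair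
class at resolution `j + m₀`, `4^{m₀} ≳ 2(4 + coeffNorm 1 K)/klE0`-type, the `≤ m₀` remaining scales being «edge scales» paid by the free envelope), and the phase-space sum.
Everything is proved; no definitions; nothing asserts any slot, stub, K3 or SC. [folklore]
-/

noncomputable section

namespace Summit.HubbardSuperconductivity.HubbardSuperconductivity.Theorems.KLRegimeSplit

set_option linter.dupNamespace false -- summit = problem name (single-conjunct summit), D-0017

open Real Finset Literature.MathematicalPhysics.QuantumLattice Literature.Probability.LatticeModels
open Literature.MathematicalPhysics.QuantumLattice.FermiRG
open Summit.HubbardSuperconductivity.HubbardSuperconductivity.Theorems.KLProgrammeLegKernels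
open Summit.HubbardSuperconductivity.HubbardSuperconductivity.Theorems.TwoPointAssembly

/-! ## §1 The quarter lemma and the centre rung size -/

/-- **Quarter lemma**: `0 ≤ A`, `A² ≤ ω² + e²`, `|e′ − e| ≤ A/2` ⟹ `(A/2)² ≤ ω² + e′²` (cases `|e| ≥ A`; `A/2 ≤ |e| < A`; `|e| < A/2`). [folklore] -/
theorem klrt_quarter_sq_le {ω e e' A : ℝ} (hA : 0 ≤ A) (h : A ^ 2 ≤ ω ^ 2 + e ^ 2) (hd : |e' - e| ≤ A / 2) : (A / 2) ^ 2 ≤ ω ^ 2 + e' ^ 2 := by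
  have h1 : |e| - A / 2 ≤ |e'| := by
    have := abs_sub_abs_le_abs_sub e e'
    rw [abs_sub_comm] at hd
    linarith
  have he : e ^ 2 = |e| ^ 2 := (sq_abs e).symm
  have he' : e' ^ 2 = |e'| ^ 2 := (sq_abs e').symm
  have h0e : 0 ≤ |e| := abs_nonneg e
  have h0e' : 0 ≤ |e'| := abs_nonneg e'
  have hω : 0 ≤ ω ^ 2 := sq_nonneg ω
  rw [he] at h
  rw [he']
  rcases le_or_gt A |e| with hA1 | hA1
  · have h2 : A / 2 ≤ |e'| := by linarith
    have h3 : (A / 2) ^ 2 ≤ |e'| ^ 2 := pow_le_pow_left₀ (by linarith) h2 2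
    linarith
  · rcases le_or_gt (A / 2) |e| with hA2 | hA2
    · have h3 : (|e| - A / 2) ^ 2 ≤ |e'| ^ 2 := pow_le_pow_left₀ (by linarith) h1 2
      nlinarith [mul_nonneg hA (sub_nonneg.2 hA1.le)]
    · have h3 : |e| ^ 2 < (A / 2) ^ 2 := by
        exact pow_lt_pow_left₀ hA2 h0e (by norm_num)
      nlinarith

section Transport

variable {L M : ℕ} [NeZero L] (β μ : ℝ) (K : TrigPolyC4v)

omit [NeZero L] in
/-- **Centre rung size**: `0 < A`, `A² ≤ ω_k² + e_K(k⃗)²` ⟹ `‖ĝ_K(k)‖ ≤ 1/A`. [folklore] -/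
theorem klrt_norm_propCT_le_one_div {A : ℝ} (hA : 0 < A) (k : FreqMomentum L M) (h : A ^ 2 ≤ matsubaraFreq β M k.1 ^ 2 + nambuXiCT L μ K k.2 ^ 2) :
    ‖propCT L M β μ K k‖ ≤ 1 / A := by
  rw [norm_propCT_eq, ← one_div]
  have hs : A ≤ Real.sqrt (matsubaraFreq β M k.1 ^ 2 + nambuXiCT L μ K k.2 ^ 2) := by
    rw [← Real.sqrt_sq hA.le]; exact Real.sqrt_le_sqrt h
  exact one_div_le_one_div_of_le hA hs

/-! ## §2 Transport across a deep step -/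

/-- **Rung sizes at the three points from the centre**: `0 < A`, `A² ≤ ω_ν² + e_K(p)²` and the deep condition `(4 + coeffNorm 1 K)·|p_Q|_𝕋 ≤ A/2` ⟹
`‖ĝ_K(ν,p+Q)‖ ≤ 2/A`, `‖ĝ_K(ν,p)‖ ≤ 2/A`, `‖ĝ_K(ν,p−Q)‖ ≤ 2/A`. [folklore] -/
theorem klrt_norm_propCT_three_le {A : ℝ} (hA : 0 < A) (ν : MatsubaraIdx M) (p Q : TorusSite 2 L)
    (h : A ^ 2 ≤ matsubaraFreq β M ν ^ 2 + nambuXiCT L μ K p ^ 2) (hdeep : (4 + K.coeffNorm 1) * klTorusNorm L Q ≤ A / 2) :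
    ‖propCT L M β μ K (ν, p + Q)‖ ≤ 2 / A ∧ ‖propCT L M β μ K (ν, p)‖ ≤ 2 / A ∧ ‖propCT L M β μ K (ν, p - Q)‖ ≤ 2 / A := by
  have hA2 : 0 < A / 2 := by positivity
  have e2A : 1 / (A / 2) = 2 / A := by field_simp
  have hp : (A / 2) ^ 2 ≤ matsubaraFreq β M ν ^ 2 + nambuXiCT L μ K (p + Q) ^ 2 :=
    klrt_quarter_sq_le hA.le h ((klbj_abs_nambuXiCT_add_sub_le μ K p Q).trans hdeep)
  have hm : (A / 2) ^ 2 ≤ matsubaraFreq β M ν ^ 2 + nambuXiCT L μ K (p - Q) ^ 2 :=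
    klrt_quarter_sq_le hA.le h ((klbj_abs_nambuXiCT_sub_sub_le μ K p Q).trans hdeep)
  refine ⟨?_, ?_, ?_⟩
  · rw [← e2A]; exact klrt_norm_propCT_le_one_div β μ K hA2 (ν, p + Q) hp
  · exact (klrt_norm_propCT_le_one_div β μ K hA (ν, p) h).trans (div_le_div_of_nonneg_right (by norm_num) hA.le)
  · rw [← e2A]; exact klrt_norm_propCT_le_one_div β μ K hA2 (ν, p - Q) hm

/-- **Band sizes at the three points from the centre**: `|e_K(p)| ≤ E` and the deep condition ⟹ `|e_K(p′)| ≤ E + A/2` at `p′ = p−Q, p, p+Q`. [folklore] -/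
theorem klrt_abs_nambuXiCT_three_le {A E : ℝ} (hA : 0 ≤ A) (p Q : TorusSite 2 L) (hE : |nambuXiCT L μ K p| ≤ E)
    (hdeep : (4 + K.coeffNorm 1) * klTorusNorm L Q ≤ A / 2) :
    |nambuXiCT L μ K (p + Q)| ≤ E + A / 2 ∧ |nambuXiCT L μ K p| ≤ E + A / 2 ∧ |nambuXiCT L μ K (p - Q)| ≤ E + A / 2 := by
  have hp := (klbj_abs_nambuXiCT_add_sub_le μ K p Q).trans hdeep
  have hm := (klbj_abs_nambuXiCT_sub_sub_le μ K p Q).trans hdeep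
  refine ⟨?_, by linarith, ?_⟩
  · have := abs_add_le (nambuXiCT L μ K (p + Q) - nambuXiCT L μ K p) (nambuXiCT L μ K p)
    rw [sub_add_cancel] at this; linarith
  · have := abs_add_le (nambuXiCT L μ K (p - Q) - nambuXiCT L μ K p) (nambuXiCT L μ K p)
    rw [sub_add_cancel] at this; linarith

/-! ## §3 The composed rows from centre data -/

/-- **Second difference of the rung from centre data**: `0 < A`, `A² ≤ ω_ν² + e_K(p)²`, deep step ⟹
`‖δ²_Q ĝ_K(ν,p)‖ ≤ ((4 + coeffNorm 2 K) + 2(4 + coeffNorm 1 K)²·(2/A))·(2/A)²·|p_Q|_𝕋²`. [folklore] -/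
theorem klrt_norm_propCT_secondDiff_le_centre (hβ : β ≠ 0) {A : ℝ} (hA : 0 < A) (ν : MatsubaraIdx M) (p Q : TorusSite 2 L)
    (h : A ^ 2 ≤ matsubaraFreq β M ν ^ 2 + nambuXiCT L μ K p ^ 2) (hdeep : (4 + K.coeffNorm 1) * klTorusNorm L Q ≤ A / 2) :
    ‖propCT L M β μ K (ν, p + Q) - 2 * propCT L M β μ K (ν, p) + propCT L M β μ K (ν, p - Q)‖ ≤
      ((4 + K.coeffNorm 2) + 2 * (4 + K.coeffNorm 1) ^ 2 * (2 / A)) * (2 / A) ^ 2 * klTorusNorm L Q ^ 2 := by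
  obtain ⟨gp, g0, gm⟩ := klrt_norm_propCT_three_le β μ K hA ν p Q h hdeep
  exact klrj_norm_propCT_secondDiff_le_of_size β μ K hβ ν p Q gp g0 gm

/-- **Second difference of the hard-shell weighted rung from centre data**: `0 < A`, `A² ≤ ω_ν² + e_K(p)²`, `|e_K(p)| ≤ E`, deep step ⟹
`‖δ²_Q(w_Λ·ĝ_K)(ν,p)‖ ≤ C(E + A/2, Λ, 2/A)·|p_Q|_𝕋²`, `C` the closed form of `klrj_norm_cutoffWeightedRung_secondDiff_le`. [folklore] -/
theorem klrt_norm_cutoffWeightedRung_secondDiff_le_centre (hβ : β ≠ 0) (Λ : ℝ) {A E : ℝ} (hA : 0 < A) (ν : MatsubaraIdx M) (p Q : TorusSite 2 L)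
    (h : A ^ 2 ≤ matsubaraFreq β M ν ^ 2 + nambuXiCT L μ K p ^ 2) (hE : |nambuXiCT L μ K p| ≤ E)
    (hdeep : (4 + K.coeffNorm 1) * klTorusNorm L Q ≤ A / 2) :
    ‖(hubbardCutoffWeightCT L M β μ K Λ (ν, p + Q) : ℂ) * propCT L M β μ K (ν, p + Q) -
          2 * ((hubbardCutoffWeightCT L M β μ K Λ (ν, p) : ℂ) * propCT L M β μ K (ν, p)) +
        (hubbardCutoffWeightCT L M β μ K Λ (ν, p - Q) : ℂ) * propCT L M β μ K (ν, p - Q)‖ ≤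
      ((16 / 3 * ((E + A / 2) * (4 + K.coeffNorm 2) + (4 + K.coeffNorm 1) ^ 2) / Λ ^ 2 +
              1408 / 9 * (E + A / 2) ^ 2 * (4 + K.coeffNorm 1) ^ 2 / Λ ^ 4) * (2 / A) +
            2 * (8 / 3 * ((4 + K.coeffNorm 1) * (2 * (E + A / 2)) / Λ ^ 2)) * (4 + K.coeffNorm 1) * (2 / A) ^ 2 +
          ((4 + K.coeffNorm 2) + 2 * (4 + K.coeffNorm 1) ^ 2 * (2 / A)) * (2 / A) ^ 2) *
        klTorusNorm L Q ^ 2 := by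
  obtain ⟨gp, g0, gm⟩ := klrt_norm_propCT_three_le β μ K hA ν p Q h hdeep
  obtain ⟨ep, e0, em⟩ := klrt_abs_nambuXiCT_three_le μ K hA.le p Q hE hdeep
  exact klrj_norm_cutoffWeightedRung_secondDiff_le β μ K hβ Λ ν p Q gp g0 gm ep e0 em

/-- **Second difference of the complementary weighted rung from centre data**: the §5 twin (`φ = w_{Λ_m} − w_{Λ_n}`). [folklore] -/
theorem klrt_norm_softWeightedRung_secondDiff_le_centre [NeZero M] (hβ : β ≠ 0) (n m : ℕ) {A E : ℝ} (hA : 0 < A) (ν : MatsubaraIdx M)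
    (p Q : TorusSite 2 L) (h : A ^ 2 ≤ matsubaraFreq β M ν ^ 2 + nambuXiCT L μ K p ^ 2) (hE : |nambuXiCT L μ K p| ≤ E)
    (hdeep : (4 + K.coeffNorm 1) * klTorusNorm L Q ≤ A / 2) :
    ‖(softSymbolCompl L M β μ K n m (ν, p + Q) : ℂ) * propCT L M β μ K (ν, p + Q) -
          2 * ((softSymbolCompl L M β μ K n m (ν, p) : ℂ) * propCT L M β μ K (ν, p)) +
        (softSymbolCompl L M β μ K n m (ν, p - Q) : ℂ) * propCT L M β μ K (ν, p - Q)‖ ≤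
      (((16 / 3 * ((E + A / 2) * (4 + K.coeffNorm 2) + (4 + K.coeffNorm 1) ^ 2) / klScale klE0 m ^ 2 +
              1408 / 9 * (E + A / 2) ^ 2 * (4 + K.coeffNorm 1) ^ 2 / klScale klE0 m ^ 4) +
            (16 / 3 * ((E + A / 2) * (4 + K.coeffNorm 2) + (4 + K.coeffNorm 1) ^ 2) / klScale klE0 n ^ 2 +
              1408 / 9 * (E + A / 2) ^ 2 * (4 + K.coeffNorm 1) ^ 2 / klScale klE0 n ^ 4)) * (2 / A) +
          2 * (8 / 3 * ((4 + K.coeffNorm 1) * (2 * (E + A / 2)) / klScale klE0 m ^ 2) +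
              8 / 3 * ((4 + K.coeffNorm 1) * (2 * (E + A / 2)) / klScale klE0 n ^ 2)) * (4 + K.coeffNorm 1) * (2 / A) ^ 2 +
          ((4 + K.coeffNorm 2) + 2 * (4 + K.coeffNorm 1) ^ 2 * (2 / A)) * (2 / A) ^ 2) * klTorusNorm L Q ^ 2 := by
  obtain ⟨gp, g0, gm⟩ := klrt_norm_propCT_three_le β μ K hA ν p Q h hdeep
  obtain ⟨ep, e0, em⟩ := klrt_abs_nambuXiCT_three_le μ K hA.le p Q hE hdeep
  exact klrj_norm_softWeightedRung_secondDiff_le β μ K hβ n m ν p Q gp g0 gm ep e0 em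

end Transport

end Summit.HubbardSuperconductivity.HubbardSuperconductivity.Theorems.KLRegimeSplit

end
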